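import Literature.Probability.RandomPlanarGeometry.HexSAWStripSurfaceLimits
import Literature.Probability.RandomPlanarGeometry.HexSAWBridgeDecay
import Literature.Probability.RandomPlanarGeometry.HexSAWBridgeLogDecay
import HarnessLib

/-!
# Below `y*` the weighted bridges of a strip vanish in the height limit: `B_T(x_c, y) → 0` (BBdGDCG §4.4, Remark 1)

Topic `Literature/Probability/RandomPlanarGeometry` (continues `HexSAWStripSurfaceLimits.lean` — the printed limits
`A_T(x_c,y) = HV.stripAyLim`, `B_T(x_c,y) = HV.stripByLim`, BBdGDCG (17) and Proposition 9 (18) — over the vocabulary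
`HV.stripGFy` of `HexSAWStripSurfaceArchCut.lean` (which also proves the arch cut (20), `HV.stripArchCut_holds`), and the
tree's `HexSAWBridgeDecay.lean`: `HV.tendsto_stripBlim`, `B_T(x_c) → 0`, with `HexSAWStripIdentity.lean`:
`HV.strip_identity_lim`, `HV.tendsto_stripAlim`).  Source: N. R. Beaton, M. Bousquet-Mélou, J. de Gier, H. Duminil-Copin, A. J. Guttmann, *The critical
fugacity for surface adsorption of self-avoiding walks on the honeycomb lattice is `1 + √2`*, Comm. Math. Phys. 326 (2014)
727–754, arXiv:1109.0358v5, §4.4, Remark 1 after Theorem 10 (p. 14): "We can actually prove that `A_T(x_c, y) → A(x_c)` for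
`y < y*`, but this will not be needed here. Returning to (18), this implies that `B_T(x_c, y) → 0` for `0 ≤ y < y*`."

## What is proved (HOME build of a-p2 g8, 2026-08-23; label CONSOLIDATION: printed claim, proof not printed — the lane's proof is
the arch cut (20) read in the other direction plus Theorem 10)

* `stripA_le_stripGFy_alpha_succ` — `A_{T,L}(x_c) ≤ A_{T+1,L}(x_c, y)` for `y ≥ 0`: an arch of `S_{T,L}` is an arch of `S_{T+1,L}`
  with no vertex on the top row of `S_{T+1}` (`surfContacts_eq_zero_of_inner_subset` of `HexSAWStripSurfaceArchCut`);
* `abs_stripGFy_alpha_succ_sub_le` — `|A_{T+1,L}(x_c,y) - A_{T,L}(x_c)| ≤ x_c · (√2 y/(1 + √2 - y)) · B_T(x_c)` for `0 < y < y*`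
  (the arch cut (20) of `HexSAWStripSurfaceArchCut` and the bound (17));
* `abs_stripAyLim_succ_sub_le` — the same for the limits: `|A_{T+1}(x_c,y) - A_T(x_c)| ≤ x_c · (√2 y/(1 + √2 - y)) · B_T(x_c)`;
* **`tendsto_stripAyLim`** — `A_{T+1}(x_c, y) → 1/cos(3π/8) = A(x_c)` as `T → ∞`, for every `0 < y < 1 + √2`
  (the tree's `tendsto_stripAlim`: `A_T(x_c) → A(x_c) = 1/cos(3π/8)`, from `B_T(x_c) → 0` and (19));
* **`tendsto_stripByLim_zero`** — `B_{T+1}(x_c, y) → 0` as `T → ∞`, for every `0 < y < 1 + √2` (Proposition 9 (18),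
  `strip_identity_limY_of_lt_yStar`, and `β(y) > 0`).
-/

noncomputable section

open Finset Filter Topology Literature.Probability.LatticeModels Literature.Probability.Percolation

namespace Literature.Probability.RandomPlanarGeometry.SAW.HV

/-- **`A_{T,L}(x_c) ≤ A_{T+1,L}(x_c, y)`** (`y ≥ 0`): every arch of `S_{T,L}` is an arch of `S_{T+1,L}` without top contacts.
[cite: BeatonBousquetMelouDeGierDuminilCopinGuttmann2014, §4.5 (arXiv v5 p. 15: "This includes arches of height at most T, which have no contacts with the top boundary")] -/
theorem stripA_le_stripGFy_alpha_succ (T L : ℕ) {y : ℝ} (hy : 0 ≤ y) :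
    stripA T L hexCriticalFugacity ≤ stripGFy (T + 1) L IsAlphaDart y := by
  have hx : 0 < hexCriticalFugacity := hexCriticalFugacity_pos_lt_one.1
  unfold stripA stripGFy
  calc ∑ P ∈ (midWalks (stripV T L)).filter (fun P => IsAlphaDart (finalDart P)), hexCriticalFugacity ^ mwLen P
      = ∑ P ∈ (midWalks (stripV T L)).filter (fun P => IsAlphaDart (finalDart P)),
          hexCriticalFugacity ^ mwLen P * y ^ surfContacts (T + 1) P := by
        refine sum_congr rfl fun P hP => ?_
        rw [surfContacts_eq_zero_of_inner_subset (mem_midWalks_iff.1 (mem_filter.1 hP).1).2.2.2.1, pow_zero, mul_one]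
    _ ≤ ∑ P ∈ (midWalks (stripV (T + 1) L)).filter (fun P => IsAlphaDart (finalDart P)),
          hexCriticalFugacity ^ mwLen P * y ^ surfContacts (T + 1) P :=
        sum_le_sum_of_subset_of_nonneg (filter_subset_filter _ (midWalks_mono (stripV_mono_T (Nat.le_succ T))))
          fun _ _ _ => by positivity

/-- **`|A_{T+1,L}(x_c, y) - A_{T,L}(x_c)| ≤ x_c · (√2 y/(1 + √2 - y)) · B_T(x_c)`** for `0 < y < y*`, `T ≥ 1`: the arch cut (20)
bounds the excess by `x_c B_{T+1,L}(x_c,y) B_T(x_c)` and (17) bounds `B_{T+1,L}(x_c,y)`.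
[cite: BeatonBousquetMelouDeGierDuminilCopinGuttmann2014, §4.5 eq. (20) and §4.2 eq. (17) (arXiv v5 pp. 14–15)] -/
theorem abs_stripGFy_alpha_succ_sub_le {T : ℕ} (hT : 1 ≤ T) (L : ℕ) {y : ℝ} (hy : 0 < y) (hlt : y < 1 + Real.sqrt 2) :
    |stripGFy (T + 1) L IsAlphaDart y - stripA T L hexCriticalFugacity| ≤
      hexCriticalFugacity * (Real.sqrt 2 * y / (1 + Real.sqrt 2 - y)) * stripBlim T := by
  have hx : 0 < hexCriticalFugacity := hexCriticalFugacity_pos_lt_one.1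
  have hB0 : 0 ≤ stripBlim T := Real.iSup_nonneg fun L => stripB_nonneg hexCriticalFugacity_pos_lt_one.1.le
  rw [abs_of_nonneg (sub_nonneg.2 (stripA_le_stripGFy_alpha_succ T L hy.le))]
  have hcut := stripArchCut_holds T L y hT hy
  have hβ := stripGFy_beta_le (T := T + 1) (L := L) (by omega) hy hlt
  calc stripGFy (T + 1) L IsAlphaDart y - stripA T L hexCriticalFugacity
      ≤ hexCriticalFugacity * stripGFy (T + 1) L (IsBetaDart (T + 1)) y * stripBlim T := hcut
    _ ≤ hexCriticalFugacity * (Real.sqrt 2 * y / (1 + Real.sqrt 2 - y)) * stripBlim T :=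
        mul_le_mul_of_nonneg_right (mul_le_mul_of_nonneg_left hβ hx.le) hB0

/-- **`|A_{T+1}(x_c, y) - A_T(x_c)| ≤ x_c · (√2 y/(1 + √2 - y)) · B_T(x_c)`** for `0 < y < y*`, `T ≥ 1` (the `L → ∞` limit of the
previous bound; `A_{T,L}(x_c) → A_T(x_c)` is the tree's `tendsto_stripA`).
[cite: BeatonBousquetMelouDeGierDuminilCopinGuttmann2014, §4.4 Remark 1 (arXiv v5 p. 14)] -/
theorem abs_stripAyLim_succ_sub_le {T : ℕ} (hT : 1 ≤ T) {y : ℝ} (hy : 0 < y) (hlt : y < 1 + Real.sqrt 2) :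
    |stripAyLim (T + 1) y - stripAlim T| ≤ hexCriticalFugacity * (Real.sqrt 2 * y / (1 + Real.sqrt 2 - y)) * stripBlim T := by
  have hA := tendsto_stripAy (T := T + 1) (by omega) hy hlt
  have hA1 := tendsto_stripA DuminilCopinSmirnov2012_lemma2_holds hT
  have hlim := (hA.sub hA1).abs
  exact le_of_tendsto' hlim fun L => abs_stripGFy_alpha_succ_sub_le hT L hy hlt

/-- **BBdGDCG §4.4, Remark 1: `A_T(x_c, y) → A(x_c) = 1/cos(3π/8)` as `T → ∞`, for every `0 < y < y* = 1 + √2`** (stated along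
`T + 1`; `A(x_c) = 1/α` by Theorem 10 and (19): `cos(3π/8) A_T(x_c) + B_T(x_c) = 1`, `B_T(x_c) → 0`).
[cite: BeatonBousquetMelouDeGierDuminilCopinGuttmann2014, §4.4 Remark 1 (arXiv v5 p. 14: "We can actually prove that A_T(x_c,y) → A(x_c) for y < y*")] -/
theorem tendsto_stripAyLim {y : ℝ} (hy : 0 < y) (hlt : y < 1 + Real.sqrt 2) :
    Tendsto (fun T : ℕ => stripAyLim (T + 1) y) atTop (𝓝 (1 / Real.cos (3 * Real.pi / 8))) := by
  -- `A_T(x_c) → 1/cos(3π/8) = A(x_c)` is the tree's `tendsto_stripAlim` (from `B_T(x_c) → 0` and (19))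
  have hA1 : Tendsto (fun T : ℕ => stripAlim (T + 1)) atTop (𝓝 (1 / Real.cos (3 * Real.pi / 8))) := by
    rw [one_div]
    exact tendsto_stripAlim.comp (tendsto_add_atTop_nat 1)
  -- the difference `A_{T+2}(y) - A_{T+1}(1)` is `O(B_{T+1}(x_c)) → 0`
  have hdiff : Tendsto (fun T : ℕ => stripAyLim (T + 1 + 1) y - stripAlim (T + 1)) atTop (𝓝 0) := by
    have hB : Tendsto (fun T : ℕ => hexCriticalFugacity * (Real.sqrt 2 * y / (1 + Real.sqrt 2 - y)) * stripBlim (T + 1))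
        atTop (𝓝 (hexCriticalFugacity * (Real.sqrt 2 * y / (1 + Real.sqrt 2 - y)) * 0)) :=
      (tendsto_stripBlim.comp (tendsto_add_atTop_nat 1)).const_mul _
    rw [mul_zero] at hB
    exact squeeze_zero_norm (fun T => abs_stripAyLim_succ_sub_le (T := T + 1) (by omega) hy hlt) hB
  have hsum := hdiff.add hA1
  rw [zero_add] at hsum
  have h3 : Tendsto (fun T : ℕ => stripAyLim (T + 1 + 1) y) atTop (𝓝 (1 / Real.cos (3 * Real.pi / 8))) :=
    hsum.congr fun T => by ring
  exact (tendsto_add_atTop_iff_nat 1).1 h3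

/-- **BBdGDCG §4.4, Remark 1: `B_T(x_c, y) → 0` as `T → ∞`, for every `0 < y < y* = 1 + √2`** (stated along `T + 1`): by
Proposition 9 (18), `β(y) B_T(x_c,y) = 1 - cos(3π/8) A_T(x_c,y) → 0`, and `β(y) > 0` below `y*`.
[cite: BeatonBousquetMelouDeGierDuminilCopinGuttmann2014, §4.4 Remark 1 (arXiv v5 p. 14: "this implies that B_T(x_c,y) → 0 for 0 ≤ y < y*")] -/
theorem tendsto_stripByLim_zero {y : ℝ} (hy : 0 < y) (hlt : y < 1 + Real.sqrt 2) :
    Tendsto (fun T : ℕ => stripByLim (T + 1) y) atTop (𝓝 0) := by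
  have hc : 0 < Real.cos (3 * Real.pi / 8) := cos_three_pi_div_eight_pos
  have hβ : 0 < betaY y := by
    rw [betaY]
    exact div_pos (by linarith) (by positivity)
  have hA := tendsto_stripAyLim hy hlt
  have h1 : Tendsto (fun T : ℕ => (1 - Real.cos (3 * Real.pi / 8) * stripAyLim (T + 1) y) / betaY y) atTop
      (𝓝 ((1 - Real.cos (3 * Real.pi / 8) * (1 / Real.cos (3 * Real.pi / 8))) / betaY y)) :=
    (tendsto_const_nhds.sub (hA.const_mul _)).div_const _
  rw [mul_one_div_cancel hc.ne', sub_self, zero_div] at h1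
  refine h1.congr fun T => ?_
  have hid := strip_identity_limY_of_lt_yStar (T := T + 1) (by omega) hy hlt
  field_simp
  linarith

/-! ### Appendix (rider): the one-row sandwich and the explicit transfer of rates from `y = 1` to `0 < y < y*` -/

/-- **`E_{T,L}(x_c) ≤ E_{T+1,L}(x_c, y)`** (`y ≥ 0`): a walk of `S_{T,L}` leaving through an oblique cut is a walk of `S_{T+1,L}`
leaving through the same cut (the class `IsEpsDart L` does not depend on `T`), with no top contact.
[cite: BeatonBousquetMelouDeGierDuminilCopinGuttmann2014, §4.5 (arXiv v5 p. 15: "arches of height at most T, which have no contacts with the top boundary"); lane: the same inclusion for the ε class] -/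
theorem stripE_le_stripGFy_eps_succ (T L : ℕ) {y : ℝ} (hy : 0 ≤ y) :
    stripE T L hexCriticalFugacity ≤ stripGFy (T + 1) L (IsEpsDart L) y := by
  have hx : 0 < hexCriticalFugacity := hexCriticalFugacity_pos_lt_one.1
  unfold stripE stripGFy
  calc ∑ P ∈ (midWalks (stripV T L)).filter (fun P => IsEpsDart L (finalDart P)), hexCriticalFugacity ^ mwLen P
      = ∑ P ∈ (midWalks (stripV T L)).filter (fun P => IsEpsDart L (finalDart P)),
          hexCriticalFugacity ^ mwLen P * y ^ surfContacts (T + 1) P := by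
        refine sum_congr rfl fun P hP => ?_
        rw [surfContacts_eq_zero_of_inner_subset (mem_midWalks_iff.1 (mem_filter.1 hP).1).2.2.2.1, pow_zero, mul_one]
    _ ≤ ∑ P ∈ (midWalks (stripV (T + 1) L)).filter (fun P => IsEpsDart L (finalDart P)),
          hexCriticalFugacity ^ mwLen P * y ^ surfContacts (T + 1) P :=
        sum_le_sum_of_subset_of_nonneg (filter_subset_filter _ (midWalks_mono (stripV_mono_T (Nat.le_succ T))))
          fun _ _ _ => by positivity

/-- **THE ONE-ROW SANDWICH (finite `L`, every `y > 0`): `β(y) · B_{T+1,L}(x_c, y) ≤ B_{T,L}(x_c)`** for `T ≥ 1` — BBdGDCG's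
identity (16) on `S_{T+1,L}` at `y` minus Duminil-Copin–Smirnov's Lemma 2 on `S_{T,L}`, the arch and cut classes of the smaller
strip being dominated by the weighted ones of the larger (`stripA_le_stripGFy_alpha_succ`, `stripE_le_stripGFy_eps_succ`): one more
row of height with surface fugacity `y` costs at most the factor `1/β(y)`.  (For `y ≥ y*`, `β(y) ≤ 0` and the bound is empty.)
[cite: BeatonBousquetMelouDeGierDuminilCopinGuttmann2014, §4.1 eq. (16) (arXiv v5 p. 13) with DuminilCopinSmirnov2012 Lemma 2; lane corollary (not stated in print)] -/
theorem betaY_mul_stripGFy_beta_succ_le {T : ℕ} (hT : 1 ≤ T) (L : ℕ) {y : ℝ} (hy : 0 < y) :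
    betaY y * stripGFy (T + 1) L (IsBetaDart (T + 1)) y ≤ stripB T L hexCriticalFugacity := by
  have hid := stripIdentityY_holds (T + 1) L y (by omega) hy
  have h2 := DuminilCopinSmirnov2012_lemma2_holds T L hT
  have hA := stripA_le_stripGFy_alpha_succ T L hy.le
  have hE := stripE_le_stripGFy_eps_succ T L hy.le
  have cα : 0 < Real.cos (3 * Real.pi / 8) := cos_three_pi_div_eight_pos
  have cε : 0 ≤ Real.cos (Real.pi / 4) := (cos_pi_div_four_pos').le
  nlinarith [mul_le_mul_of_nonneg_left hA cα.le, mul_le_mul_of_nonneg_left hE cε]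

/-- **`β(y) · B_{T+1}(x_c, y) ≤ B_T(x_c)`** for `0 < y < y* = 1 + √2` and `T ≥ 1` (the `L → ∞` limit of the one-row sandwich):
the `y`-weighted critical bridge generating function inherits EVERY decay rate of `B_T(x_c, 1)` (Krachun–Panagiotis `T^{-ε}`,
Glazman–Manolescu `(ln T)^{-1/3}`, both in the tree) up to the explicit factor `1/β(y) = √2 y/(1 + √2 − y)`.
[cite: BeatonBousquetMelouDeGierDuminilCopinGuttmann2014, §4.4 Remark 1 (arXiv v5 p. 14) — quantitative form; lane corollary] -/
theorem betaY_mul_stripByLim_succ_le {T : ℕ} (hT : 1 ≤ T) {y : ℝ} (hy : 0 < y) (hlt : y < 1 + Real.sqrt 2) :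
    betaY y * stripByLim (T + 1) y ≤ stripBlim T := by
  have hB := (tendsto_stripBy (T := T + 1) (by omega) hy hlt).const_mul (betaY y)
  have hB1 := tendsto_stripB DuminilCopinSmirnov2012_lemma2_holds hT
  exact le_of_tendsto_of_tendsto' hB hB1 fun L => betaY_mul_stripGFy_beta_succ_le hT L hy

/-- **`B_{T+1}(x_c, y) ≤ (√2 y/(1 + √2 − y)) · B_T(x_c)`** for `0 < y < y*`, `T ≥ 1` (solved form; `1/β(y) = √2 y/(1 + √2 − y)`).
[cite: BeatonBousquetMelouDeGierDuminilCopinGuttmann2014, §4.4 Remark 1 (arXiv v5 p. 14) — quantitative form; lane corollary] -/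
theorem stripByLim_succ_le_mul {T : ℕ} (hT : 1 ≤ T) {y : ℝ} (hy : 0 < y) (hlt : y < 1 + Real.sqrt 2) :
    stripByLim (T + 1) y ≤ Real.sqrt 2 * y / (1 + Real.sqrt 2 - y) * stripBlim T := by
  have hβ : 0 < betaY y := by rw [betaY]; exact div_pos (by linarith) (by positivity)
  have h := betaY_mul_stripByLim_succ_le hT hy hlt
  have hinv : Real.sqrt 2 * y / (1 + Real.sqrt 2 - y) = (betaY y)⁻¹ := by
    rw [betaY, inv_div]
  rw [hinv, inv_mul_eq_div, le_div_iff₀ hβ, mul_comm]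
  exact h

/-! ### Appendix 2 (rider): the displayed rate — Glazman–Manolescu's `(ln T)^{-1/3}` for every `0 < y < y*` -/

/-- **`B_{T+1}(x_c, y) ≤ (√2 y/(1 + √2 − y)) · 5 (ln T)^{−1/3}`** for `0 < y < y* = 1 + √2` and `T ≥ 2`: the explicit rate
transfer `stripByLim_succ_le_mul` composed with the tree's Glazman–Manolescu decay `hexBridgeLogDecay : B_T(x_c) ≤ 5 (ln T)^{−1/3}`
(`HexSAWBridgeLogDecay.lean`). [cite: GlazmanManolescu2019, Proposition 1.1 (arXiv v3: B_T(x_c) → 0 with the (log T)^{-1/3} rate of §4); BeatonBousquetMelouDeGierDuminilCopinGuttmann2014, §4.4 Remark 1 (arXiv v5 p. 14) — quantitative form; lane corollary] -/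
theorem stripByLim_succ_le_log {T : ℕ} (hT : 2 ≤ T) {y : ℝ} (hy : 0 < y) (hlt : y < 1 + Real.sqrt 2) :
    stripByLim (T + 1) y ≤ Real.sqrt 2 * y / (1 + Real.sqrt 2 - y) * (5 * Real.log T ^ (-(1 : ℝ) / 3)) := by
  have h1 := stripByLim_succ_le_mul (T := T) (by omega) hy hlt
  have h2 : stripBlim T ≤ 5 * Real.log T ^ (-(1 : ℝ) / 3) := hexBridgeLogDecay T hT
  have hc : 0 ≤ Real.sqrt 2 * y / (1 + Real.sqrt 2 - y) := div_nonneg (by positivity) (by linarith)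
  exact h1.trans (mul_le_mul_of_nonneg_left h2 hc)

end Literature.Probability.RandomPlanarGeometry.SAW.HV
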